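import Mathlib
import HarnessLib
import Summits.HubbardSuperconductivity.HubbardSuperconductivity.Theorems.KLProgrammeCooperChannelRiccatiFlowEnvelope

/-!
# Route `KLProgramme` — C2 (VIII): the SCALAR two-sided block envelopes from per-scale cascade comparisons
# (the form in which child 1 `BetaSplit` consumes the engine's (E2))

Cell gate-hubbard-kl, seat p3; companion of `KLProgrammeCooperChannelRiccatiFlowEnvelope.lean` (III).  The K3 split
(`KLProgrammeKLRegimeSplitPredicates.lean`) states the engine's Cooper-channel output (E2) `CooperCascadeStep` as SCALAR one-step
comparisons of the block bottoms/tops `lo_k = klLocBlockInf … k χ`, `hi_k = klLocBlockSup … k χ` with a bubble mass `b_k ∈ [blo, bhi]`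
and costs `cost_k = ē + drive`, `costP_k = ē + drive⁺`, and child 1's (B1) `CooperBlocksInEnvelopes` as the two-sided envelopes
with the DETERMINISTIC majorants `A₀' + Σ_{j<k} cost_j`, `bhi·k`, `A⁺₀' + Σ_{j<k} costP_j`.  This file is the passage, once and for
all, at the level of real sequences (no operators, no model):

* `attractiveEnvelope_anti_left` — the envelope is decreasing in the drive (`A ≤ A'`, before the onset);
* `cascade_pos_of_lower_envelope` — before the onset `(A₀ + Σ_{j<N} cost)(Σ_{j<N} b) < 1`, a sequence above the attractive lower
  envelope keeps `1 + b_k x_k > 0` (the branch condition of `cascadeStep`) for `k < N`;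
* **`scalar_block_envelopes`** — from `-A₀ ≤ lo_0`, `hi_0 ≤ A⁺₀`, `lo_k ≤ hi_k`, the steps
  `cascadeStep b_k lo_k - cost_k ≤ lo_{k+1}`, `hi_{k+1} ≤ cascadeStep b_k hi_k + costP_k` (`k < N`), `0 ≤ b_k ≤ bhi`, and the no-onset
  condition on the MAJORANTS `(A₀' + Σ_{j<N} cost_j)·(bhi·N) < 1` (`A₀ ≤ A₀'`, `A⁺₀ ≤ A⁺₀'`): for all `k ≤ N`,
  `attractiveEnvelope (A₀' + Σ_{j<k} cost_j) (bhi·k) ≤ lo_k` and `hi_k ≤ A⁺₀' + Σ_{j<k} costP_j`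
  (`attractive_lower_envelope` + monotonicity in both arguments; `upper_envelope_of_step_le` with the branch condition supplied by
  the lower envelope).

Indexing convention (C2's, = (B1)'s): the step `k → k+1` is charged `cost_k` and uses the mass `b_k`; the envelope at `k` carries
`Σ_{j<k}`.  Everything is proved; no definitions.  References: HOME/p3/C2-LEAN-GUIDE.md §2; DECOMP App. E Lemma E.4 (B1).
-/

noncomputable section

namespace Summit.HubbardSuperconductivity.HubbardSuperconductivity.Theorems.CooperChannelRiccatiFlow

set_option linter.dupNamespace false -- summit = problem name (single-conjunct summit), D-0017

open Finset

/-- **The attractive envelope is decreasing in the drive**: `0 ≤ A ≤ A'`, `0 ≤ B`, `A' B < 1` ⇒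
`attractiveEnvelope A' B ≤ attractiveEnvelope A B`. -/
theorem attractiveEnvelope_anti_left {A A' B : ℝ} (hA : 0 ≤ A) (hAA' : A ≤ A') (hB : 0 ≤ B) (h : A' * B < 1) :
    attractiveEnvelope A' B ≤ attractiveEnvelope A B := by
  have := attractiveEnvelope_add_le hA (sub_nonneg.2 hAA') hB (by rwa [add_sub_cancel])
  rw [add_sub_cancel] at this
  linarith [sub_nonneg.2 hAA']

/-- **The attractive envelope is monotone in both arguments at once** (drive up, mass up ⇒ envelope down), before the onset of
the larger pair. -/
theorem attractiveEnvelope_anti {A A' B B' : ℝ} (hA : 0 ≤ A) (hAA' : A ≤ A') (hB : 0 ≤ B) (hBB' : B ≤ B') (h : A' * B' < 1) :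
    attractiveEnvelope A' B' ≤ attractiveEnvelope A B :=
  (attractiveEnvelope_anti_right (hA.trans hAA') hBB' h).trans
    (attractiveEnvelope_anti_left hA hAA' hB (lt_of_le_of_lt (mul_le_mul_of_nonneg_left hBB' (hA.trans hAA')) h))

/-- **Branch condition from the lower envelope**: with `b_k, cost_k ≥ 0`, `A₀ ≥ 0` and no onset up to `N`
(`(A₀ + Σ_{j<N} cost_j)(Σ_{j<N} b_j) < 1`), a sequence `x` with `attractiveEnvelope (A₀ + Σ_{j<k} cost_j) (Σ_{j<k} b_j) ≤ x_k`
has `0 < 1 + b_k x_k` for every `k < N`. -/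
theorem cascade_pos_of_lower_envelope {b cost x : ℕ → ℝ} {A₀ : ℝ} {N : ℕ} (hb : ∀ k, 0 ≤ b k) (hcost : ∀ k, 0 ≤ cost k)
    (hA₀ : 0 ≤ A₀) (honset : (A₀ + ∑ j ∈ range N, cost j) * (∑ j ∈ range N, b j) < 1)
    (henv : ∀ k ≤ N, attractiveEnvelope (A₀ + ∑ j ∈ range k, cost j) (∑ j ∈ range k, b j) ≤ x k) :
    ∀ k < N, 0 < 1 + b k * x k := by
  intro k hk
  set A : ℝ := A₀ + ∑ j ∈ range k, cost j with hA_def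
  set B : ℝ := ∑ j ∈ range k, b j with hB_def
  have hA : 0 ≤ A := add_nonneg hA₀ (sum_nonneg fun j _ => hcost j)
  have hB : 0 ≤ B := sum_nonneg fun j _ => hb j
  have hAle : A ≤ A₀ + ∑ j ∈ range N, cost j :=
    add_le_add le_rfl (sum_le_sum_of_subset_of_nonneg (range_mono hk.le) fun j _ _ => hcost j)
  have hBle : B + b k ≤ ∑ j ∈ range N, b j := by
    rw [hB_def, ← sum_range_succ]
    exact sum_le_sum_of_subset_of_nonneg (range_mono (Nat.succ_le_of_lt hk)) fun j _ _ => hb j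
  have hABN : A * (B + b k) < 1 :=
    lt_of_le_of_lt (mul_le_mul hAle hBle (add_nonneg hB (hb k)) (hA.trans hAle)) honset
  have hAB : A * B < 1 := lt_of_le_of_lt (mul_le_mul_of_nonneg_left (le_add_of_nonneg_right (hb k)) hA) hABN
  have h1 : 0 < 1 - A * B := by linarith
  -- `1 + b x ≥ 1 + b · env = (1 - A (B + b)) / (1 - A B) > 0`
  have henvk := henv k hk.le
  have hpos : 0 < 1 + b k * attractiveEnvelope A B := by
    rw [one_add_mul_attractiveEnvelope h1.ne']
    exact div_pos (by linarith) h1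
  calc (0 : ℝ) < 1 + b k * attractiveEnvelope A B := hpos
    _ ≤ 1 + b k * x k := by gcongr; exact hb k

/-- **The scalar two-sided block envelopes (C2 ⇒ (B1)).**  Block bottoms `lo` and tops `hi` (`lo_k ≤ hi_k`) with initial data
`-A₀ ≤ lo_0`, `hi_0 ≤ A⁺₀` (`0 ≤ A₀ ≤ A₀'`, `0 ≤ A⁺₀ ≤ A⁺₀'`), one-step comparisons `cascadeStep b_k lo_k - cost_k ≤ lo_{k+1}` and
`hi_{k+1} ≤ cascadeStep b_k hi_k + costP_k` for `k < N` with masses `0 ≤ b_k ≤ bhi` and costs `cost_k ≥ 0`, and no onset for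
the MAJORANTS, `(A₀' + Σ_{j<N} cost_j)·(bhi·N) < 1`: then for every `k ≤ N`,
`attractiveEnvelope (A₀' + Σ_{j<k} cost_j) (bhi·k) ≤ lo_k` and `hi_k ≤ A⁺₀' + Σ_{j<k} costP_j`. -/
theorem scalar_block_envelopes {b cost costP lo hi : ℕ → ℝ} {A₀ A₀' Atop Atop' bhi : ℝ} {N : ℕ}
    (hb : ∀ k, 0 ≤ b k) (hbhi : ∀ k, b k ≤ bhi) (hcost : ∀ k, 0 ≤ cost k)
    (hA₀ : 0 ≤ A₀) (hAA : A₀ ≤ A₀') (htop : Atop ≤ Atop')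
    (hlo0 : -A₀ ≤ lo 0) (hhi0 : hi 0 ≤ Atop) (hlohi : ∀ k, lo k ≤ hi k)
    (hstep : ∀ k < N, cascadeStep (b k) (lo k) - cost k ≤ lo (k + 1) ∧ hi (k + 1) ≤ cascadeStep (b k) (hi k) + costP k)
    (honset : (A₀' + ∑ j ∈ range N, cost j) * (bhi * N) < 1) :
    ∀ k ≤ N, attractiveEnvelope (A₀' + ∑ j ∈ range k, cost j) (bhi * k) ≤ lo k ∧ hi k ≤ Atop' + ∑ j ∈ range k, costP j := by
  have hbhi0 : 0 ≤ bhi := (hb 0).trans (hbhi 0)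
  -- sums of masses against `bhi · k`
  have hBle : ∀ k, ∑ j ∈ range k, b j ≤ bhi * k := fun k =>
    calc ∑ j ∈ range k, b j ≤ ∑ j ∈ range k, bhi := sum_le_sum fun j _ => hbhi j
      _ = bhi * k := by rw [sum_const, card_range, nsmul_eq_mul, mul_comm]
  have hA'N : 0 ≤ A₀' + ∑ j ∈ range N, cost j := add_nonneg (hA₀.trans hAA) (sum_nonneg fun j _ => hcost j)
  -- no onset for the true masses
  have honset' : (A₀ + ∑ j ∈ range N, cost j) * (∑ j ∈ range N, b j) < 1 :=
    lt_of_le_of_lt (mul_le_mul (add_le_add hAA le_rfl) (hBle N) (sum_nonneg fun j _ => hb j) hA'N) honset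
  -- the lower envelope for the true data
  have hlow := attractive_lower_envelope (x := lo) hb hcost hA₀ hlo0 honset' fun k hk _ => (hstep k hk).1
  -- branch condition, then the upper envelope
  have hpos : ∀ k < N, 0 < 1 + b k * hi k := fun k hk =>
    lt_of_lt_of_le (cascade_pos_of_lower_envelope hb hcost hA₀ honset' hlow k hk)
      (by gcongr; exacts [hb k, hlohi k])
  have hup := upper_envelope_of_step_le (x := hi) (e := costP) hb hpos fun k hk => (hstep k hk).2
  intro k hk
  refine ⟨?_, (hup k hk).trans (add_le_add (hhi0.trans htop) le_rfl)⟩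
  -- monotonicity of the envelope in both arguments
  have hAk : 0 ≤ A₀ + ∑ j ∈ range k, cost j := add_nonneg hA₀ (sum_nonneg fun j _ => hcost j)
  have hmono : A₀' + ∑ j ∈ range k, cost j ≤ A₀' + ∑ j ∈ range N, cost j :=
    add_le_add le_rfl (sum_le_sum_of_subset_of_nonneg (range_mono hk) fun j _ _ => hcost j)
  have hkN : bhi * k ≤ bhi * N := mul_le_mul_of_nonneg_left (by exact_mod_cast hk) hbhi0
  have honk : (A₀' + ∑ j ∈ range k, cost j) * (bhi * k) < 1 :=
    lt_of_le_of_lt (mul_le_mul hmono hkN (mul_nonneg hbhi0 (Nat.cast_nonneg k)) hA'N) honset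
  exact (attractiveEnvelope_anti hAk (add_le_add hAA le_rfl) (sum_nonneg fun j _ => hb j) (hBle k) honk).trans (hlow k hk)

end Summit.HubbardSuperconductivity.HubbardSuperconductivity.Theorems.CooperChannelRiccatiFlow

end
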